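import Literature.Computability.AlgebraicComplexity.TableauEvalLabelMajor
import HarnessLib

/-!
# Label-major evaluation of tableau highest-weight vectors with a SPARSE entry trie

Topic `Computability/AlgebraicComplexity`; an EXECUTABLE definitions file (kernel-evaluable by
`decide +kernel`, structural recursion only) extending the Lean certificate checker of the GCT
multiplicity-obstruction engine (cells `pub-gct` / `pub-gct-max`; honest framing of those cells:
multiplicity-obstruction search for permanent versus determinant at small `(n, m)` — a kernel-checked
LOWER bound `r ≤ mult` at a small parameter is negative census or an ingredient of a certificate, never a
claim about VP ≠ VNP or P ≠ NP).

`TableauEval.evalA` (`TableauEvalLabelMajor.lean`) runs the label-major programme against the pruned trie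
`buildPTrie P V m []`, whose construction evaluates the symmetric-tensor entry `symEntry P w` (a sum of
`#terms` permanents of `m × m` matrices) at EVERY one of the `V^m` words — for `m = 4`, `V = 10`
(determinant-side points of `det₄`) about `2·10⁷` ring operations, beyond one kernel evaluation. The
entries are the polarisations of ONE form `q = ∑_t c_t ∏_s ℓ_{t,s}` and almost all of them vanish for the
sparse points a certificate generator chooses. This file builds the SAME trie values from the sparse
ORDERED EXPANSION of `q`: for every term `t` and every arrangement `π ∈ S_m` of its `m` forms over the `m`
positions, the words `w` with `w_p ∈ support(ℓ_{t,π p})` carry `c_t ∏_p ℓ_{t,π p}[w_p]`; summed over `(t, π)`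
at a fixed word this is `∑_t c_t perm(ℓ_{t,s}[w_{s'}]) = symEntry P w` (column expansion of the
permanent), so inserting all these contributions into a trie with ADDITION at the leaves and pruning zero
subtrees gives a trie `sparseTrie P V m` with `find w = symEntry P w` on every word of length `m` with
letters `< V` (proofs file `TableauEvalSparseEntryImpl.lean`, theorem `find_sparseTrie`), at a cost
proportional to `#terms · m! · ∏_s #support(ℓ_{t,s})` instead of `V^m · #terms · m! · m`. The programme
`evalS` is `evalA` with this trie; `evalS = evalC` for column-strict networks (`evalS_eq_evalC`, proofs
file) by the tree's trie-parametric chain `layerSum_layersA` / `specL_eq_evalC`; the proofs file also has the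
chunking identity `layersA_append` used by certificate modules that ship intermediate layers and check the
walk a few labels at a time (one `decide +kernel` per chunk).

Contents: §1 supports, product words, the ordered expansion `termWords`, the symmetrised expansion
`symList`; §2 tries built by insertion (`PTrie.setPad`, `PTrie.insertAdd`, `PTrie.ofList`, `PTrie.prune`),
`sparseTrie`; §3 the programme `evalS`; §4 kernel sanity values. Elementary
[folklore] bookkeeping around the polarisation formula of [DorflerIkenmeyerPanova2020, §5]; no statement
about representations is made in this file.

## References
* [DorflerIkenmeyerPanova2020] J. Dörfler, C. Ikenmeyer, G. Panova, *On geometric complexity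
  theory: multiplicity obstructions are stronger than occurrence obstructions*, SIAM J. Appl.
  Algebra Geom. 4 (2020) = arXiv:1901.04576, §5.
* [BurgisserIkenmeyer2013] P. Bürgisser, C. Ikenmeyer, *Explicit lower bounds via geometric
  complexity theory*, STOC 2013 = arXiv:1210.8368, §4.
-/

namespace Literature.Computability.AlgebraicComplexity

namespace TableauEval

/-! ## §1 The sparse symmetrised expansion of a sum of products of linear forms -/

section Expansion

variable {R : Type*} [CommRing R] [DecidableEq R]

/-- The variables `v < V` with a nonzero coefficient in the linear form `ℓ` (increasing). [folklore] -/
def support (V : ℕ) (ℓ : List R) : List ℕ :=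
  (List.range V).filter fun v => !decide (ℓ.getD v 0 = 0)

/-- All words choosing, in order, one letter from each of the given lists. [folklore] -/
def prodWords : List (List ℕ) → List (List ℕ)
  | [] => [[]]
  | S :: Ss => S.flatMap fun v => (prodWords Ss).map fun w => v :: w

/-- **Ordered expansion of one product of linear forms**, the forms arranged over the positions by
the index list `q` (position `p` carries the form `forms[q p]`): the pairs
`(w, ∏_p forms[q p][w_p])` over the words `w` with every `w_p` in the support of `forms[q p]`
(every other word has product `0`). [folklore] -/
def termWords (V : ℕ) (forms : List (List R)) (q : List ℕ) : List (List ℕ × R) :=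
  let sup := forms.map (support V)
  let fs := q.map fun j => forms.getD j []
  (prodWords (q.map fun j => sup.getD j [])).map fun w =>
    (w, (List.zipWith (fun (ℓ : List R) (v : ℕ) => ℓ.getD v 0) fs w).prod)

/-- **The symmetrised sparse expansion** of the point `P = ∑_t c_t ∏_s ℓ_{t,s}` in `m` positions
over the variables `< V`: for every term and every arrangement `q ∈ S_m` of its forms over the
positions, the ordered expansion scaled by `c_t`. The contributions at a fixed word `w` of length
`m` add up to `symEntry P w` (proofs file). [folklore] -/
def symList (P : Point R) (V m : ℕ) : List (List ℕ × R) :=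
  P.terms.flatMap fun t => (permsSign (List.range m)).flatMap fun q =>
    (termWords V t.2 q.2).map fun e => (e.1, t.1 * e.2)

end Expansion

/-! ## §2 Tries built by insertion -/

section Insert

variable {R : Type*} [CommRing R] [DecidableEq R]

/-- Set position `i` of a list of children to `t`, padding with `empty` children as needed.
[folklore] -/
def PTrie.setPad : List (PTrie R) → ℕ → PTrie R → List (PTrie R)
  | [], 0, t => [t]
  | [], i + 1, t => .empty :: PTrie.setPad [] i t
  | _ :: ts, 0, t => t :: ts
  | s :: ts, i + 1, t => s :: PTrie.setPad ts i t

/-- **Insert with addition**: add `a` to the value stored at the word `w`, creating the path (a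
`leaf` met before the end of the word, or a `node` met at its end, holds no value for words of
this length and is replaced). [folklore] -/
def PTrie.insertAdd : List ℕ → R → PTrie R → PTrie R
  | [], a, .leaf b => .leaf (b + a)
  | [], a, .empty => .leaf a
  | [], a, .node _ => .leaf a
  | i :: is, a, .node ts => .node (PTrie.setPad ts i (PTrie.insertAdd is a (ts.getD i .empty)))
  | i :: is, a, .empty => .node (PTrie.setPad [] i (PTrie.insertAdd is a .empty))
  | i :: is, a, .leaf _ => .node (PTrie.setPad [] i (PTrie.insertAdd is a .empty))

/-- The trie of a list of `(word, value)` contributions, values at equal words added. [folklore] -/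
def PTrie.ofList (L : List (List ℕ × R)) : PTrie R :=
  L.foldl (fun T e => T.insertAdd e.1 e.2) .empty

/-- Prune zero leaves and all-empty nodes down to depth `k` (lookups unchanged; the walk of the
label-major programme then skips them). [folklore] -/
def PTrie.prune : ℕ → PTrie R → PTrie R
  | _, .empty => .empty
  | _, .leaf a => PTrie.mkLeaf a
  | 0, .node ts => .node ts
  | k + 1, .node ts => PTrie.mkNode (ts.map (PTrie.prune k))

/-- **The sparse entry trie** of the point `P` for words of length `m` over the variables `< V`:
`find w = symEntry P w` on every such word (proofs file, `find_sparseTrie`). [folklore] -/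
def sparseTrie (P : Point R) (V m : ℕ) : PTrie R :=
  PTrie.prune m (PTrie.ofList (symList P V m))

end Insert

/-! ## §3 The programme with the sparse trie -/

section Program

variable {R : Type*} [CommRing R] [DecidableEq R]

/-- **Label-major evaluation of the tableau network `N` at the point `P`, sparse entry trie** —
`evalA` with `sparseTrie` in place of `buildPTrie`; equal to `evalC P N` for column-strict networks
passing the structural check (proofs file, `evalS_eq_evalC`). [folklore] -/
def evalS (P : Point R) (N : Network) : R :=
  layerSum (layersA N.cols N.varBound (sparseTrie P N.varBound N.perLabel)
    (List.range N.nlabels) N.initLayer)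

end Program

/-! ## §4 Sanity values (kernel) -/

/-- On the toy network `1 1 / 2 2` at `2 x₀ x₁` presented as two products, the sparse trie holds
`symEntry` at the four words and `evalS = evalC = -8`. [folklore] -/
example :
    let P : Point ℤ := ⟨[(1, [[1, 0], [0, 1]]), (1, [[0, 1], [1, 0]])]⟩
    let N : Network := ⟨2, 2, [⟨[0, 1], [0, 1]⟩, ⟨[0, 1], [0, 1]⟩]⟩
    ([[0, 0], [0, 1], [1, 0], [1, 1]].map fun w => (sparseTrie P 2 2).find w) =
        ([[0, 0], [0, 1], [1, 0], [1, 1]].map fun w => symEntry P w) ∧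
      evalS P N = -8 ∧ evalC P N = -8 := by
  decide +kernel

/-- A `3 × 3` cross-check in the kernel (the one of `TableauEvalLabelMajor.lean`): shape `(5,2,2)`,
`d = m = 3`, at `per₃` of a `0/1` matrix with two doubled entries, modulo `101`:
`evalS = evalA = evalC`. [folklore] -/
example :
    let g : List (List (ZMod 101)) := [[1, 1, 0, 1, 0, 0, 0, 0, 0], [0, 0, 0, 0, 1, 0, 0, 0, 1],
      [1, 0, 0, 0, 0, 0, 0, 0, 0], [0, 0, 1, 0, 0, 0, 0, 0, 0], [0, 0, 0, 0, 0, 0, 0, 1, 0],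
      [0, 0, 0, 0, 0, 0, 1, 0, 0], [0, 0, 0, 0, 0, 1, 0, 0, 0], [0, 0, 0, 0, 1, 0, 0, 0, 0],
      [0, 0, 0, 0, 0, 0, 0, 0, 0]]
    let P : Point (ZMod 101) := ⟨(permsSign [0, 1, 2]).map fun q =>
      (1, (List.range 3).map fun i => g.map fun row => row.getD (i * 3 + q.2.getD i 0) 0)⟩
    let N : Network := ⟨3, 3, [⟨[0, 1, 2], [0, 1, 2]⟩, ⟨[0, 1, 2], [0, 1, 2]⟩, ⟨[0], [0]⟩,
      ⟨[0], [1]⟩, ⟨[0], [2]⟩]⟩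
    evalS P N = evalA P N ∧ evalS P N = evalC P N := by
  decide +kernel

end TableauEval

end Literature.Computability.AlgebraicComplexity
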